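import Literature.NumberTheory.Automorphic.PairLFunctionPolesEqConjFirstMoment
import HarnessLib

/-!
# Arthur–Clozel (2.3) from a ONE-SIDED REAL LOWER BOUND for the partial `L`-function at `s = 1`

Topic `NumberTheory/Automorphic`; namespace `Literature.NumberTheory.Automorphic`. Proof file (theorems
only) under the named fact `JacquetShalika1981_partialPairL_pole_of_eq_conj` (`PairLFunctionPoles`;
Arthur–Clozel (1989), Ch. 3 §2 (2.3): for unitary cuspidal `π ≅ σ̃`,
`lim_{s → 1, Re s > 1} (s - 1) L^S(s, π ⊗ σ)` exists, finite and non-zero).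

`PairLFunctionPolesEqConjFirstMoment` reduced the fact, in every rank, to the finiteness AT `s = 1` of the
bad-place part `Ψ_{S'}(1) = ∫ G w dm` of the unfolded Rankin–Selberg integral of a datum (`G ≥ 0`,
`w = |det a| > 0`); the tree knows `I(s) = C · (∫ G w^s dm) · L^{S'}(s)` on `1 < Re s < 2`, the residue
`(s - 1) I(s) → r ≠ 0` and `∫ G w² dm < ∞`. This file observes that the finiteness at `s = 1` — hence
the fact — already follows from the **one-sided real lower bound**

  `liminf_{σ → 1⁺} (σ - 1) ‖L^{S'}(σ, β ⊗ β̄)‖ > 0`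

for the Satake families `β` of cuspidal representations (`JacquetShalika1981_partialPairL_pole_of_eq_conj_of_lower_bound`):
at real `σ ∈ (1, 2)` the identity gives `∫ G w^σ dm = (σ - 1) I(σ) / (C (σ - 1) L^{S'}(σ)) = O(1)`, and
**Fatou's lemma** along `σ → 1⁺` gives `∫ G w dm ≤ liminf ∫ G w^σ dm < ∞`; the moment lemma
`exists_ne_zero_tendsto_sub_one_mul_of_integral_mul_cpow` then supplies the complex limit, its existence
and its non-vanishing. Conversely the fact trivially gives the lower bound
(`partialPairL_lower_bound_of_pole`), so **(2.3) is EQUIVALENT to this real inequality for Dirichlet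
series with non-negative coefficients**; what the tree lacks for `n ≥ 3` is exactly a proof that the bad
local factors do not eat the pole, i.e. the archimedean (and ramified) Rankin–Selberg theory at `s = 1`
(Jacquet–Shalika I, §1, §3, Prop. (3.17)) or Mœglin–Waldspurger's continuation
(`MoeglinWaldspurger1989_partialPairL_of_eq_conj`).

## References

* J. Arthur, L. Clozel, *Simple algebras, base change, and the advanced theory of the trace formula*,
  Ann. of Math. Stud. 120 (1989), Ch. 3 §2, (2.3), p. 171 [ArthurClozelAMS120].
* H. Jacquet, J. A. Shalika, *On Euler products and the classification of automorphic representations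
  I*, Amer. J. Math. 103 (1981), §1, §3 (Prop. (3.17)), §4 [JacquetShalikaAJM1981]; *II*, Prop. 3.6.
* J. W. Cogdell, *Analytic theory of L-functions for GL_n* (2004), §2.3, Thm. 3.2 (1), §4.2
  [CogdellAnalyticTheory2004].
-/

noncomputable section

open MeasureTheory Measure NumberField IsDedekindDomain Matrix Set Filter Finset Topology
open scoped MatrixGroups ENNReal NNReal Pointwise ValuativeRel ComplexConjugate
open Literature.RingTheory.SymmetricFunctions.SymmPoly
open Literature.NumberTheory.GaloisRepresentations (ideleGroup)

namespace Literature.NumberTheory.Automorphic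

-- the automorphic quotient carries the tree's Borel σ-algebra, not Mathlib's quotient σ-algebra
attribute [-instance] Quotient.instMeasurableSpace QuotientGroup.measurableSpace

section LowerBound

variable {n : ℕ} {K : Type} [Field K] [NumberField K]
variable {μ' : Measure (AdelicGroupData.gl n K).automorphicQuotient}
  [(AdelicGroupData.gl n K).IsAutomorphicMeasure μ']

attribute [local instance] adelicBorel borelSpace_adelic locallyCompactSpace_adelic secondCountableTopology_gl_adelic
  glAdeleBorel borelSpace_glAdele

/-- Real points `σ → 1⁺` approach `1` inside the half-plane `Re s > 1`. [folklore] -/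
theorem tendsto_ofReal_nhdsWithin_one :
    Tendsto (fun σ : ℝ => (σ : ℂ)) (𝓝[>] 1) (𝓝[{s : ℂ | 1 < s.re}] 1) := by
  refine tendsto_nhdsWithin_iff.2 ⟨?_, ?_⟩
  · have h : Tendsto (fun σ : ℝ => (σ : ℂ)) (𝓝 1) (𝓝 ((1 : ℝ) : ℂ)) := Complex.continuous_ofReal.tendsto 1
    rw [Complex.ofReal_one] at h
    exact h.mono_left nhdsWithin_le_nhds
  · filter_upwards [self_mem_nhdsWithin] with σ hσ
    simpa using hσ

/-- **Arthur–Clozel (2.3) from the one-sided real lower bound `liminf_{σ→1⁺} (σ-1)‖L^{S}(σ, β ⊗ β̄)‖ > 0`.**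
Suppose that for every cuspidal automorphic representation `Π` of `GL_n(𝔸_K)`, every finite set `S` of
finite places and every Satake family `β` of `Π` off `S` there is `c > 0` with
`c ≤ (σ - 1) ‖L^S(σ, β ⊗ β̄)‖` for all real `σ > 1` close to `1`. Then the named fact
`JacquetShalika1981_partialPairL_pole_of_eq_conj` holds in rank `n` over `K`. Proof: the proof of
`JacquetShalika1981_partialPairL_pole_of_eq_conj_of_firstMoment` verbatim (datum, level, exceptional set,
Gaussian test function, residue, unfolding, Euler factorisation, moment integrand), except that the
finiteness of the first moment `∫ G w dm` is DERIVED: at real `σ ∈ (1, 2)` near `1`,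
`‖(σ-1) I(σ)‖ = C (∫ G w^σ dm) (σ-1)‖L^{S'}(σ)‖ ≥ C c ∫ G w^σ dm` bounds the `σ`-moments, and Fatou's lemma
along `σ → 1⁺` bounds `∫ G w dm`. [cite: ArthurClozelAMS120, Ch. 3 §2 (2.3)]
[cite: JacquetShalikaAJM1981, §1, Prop. (3.17), §4; II Prop. 3.6] [cite: CogdellAnalyticTheory2004, Thm. 3.2 (1), §4.2] -/
theorem JacquetShalika1981_partialPairL_pole_of_eq_conj_of_lower_bound
    (hL : ∀ (P : CuspidalAutomorphicRepGL n K μ') (S' : Set (HeightOneSpectrum (𝓞 K))), S'.Finite →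
      ∀ (β : SatakeFamily K), IsSatakeFamilyOf P S' β →
        ∃ c : ℝ, 0 < c ∧ ∀ᶠ σ : ℝ in 𝓝[>] 1, c ≤ (σ - 1) * ‖partialPairL S' β (conjFamily β) (σ : ℂ)‖) :
    JacquetShalika1981_partialPairL_pole_of_eq_conj (n := n) (K := K) (μ := μ') := by
  refine JacquetShalika1981_partialPairL_pole_of_eq_conj_of_one_family'
    JacquetShalika1981_multipliable_partialPairL_holds
    (fun P _ _ hα _ hv _ ha => norm_satakeParameter_lt_sqrt_of_isGeneric
      exists_hasLocalComponentAt_holds Flath1979_isSatakeParameter_of_hasLocalComponentAt_holds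
      Shalika1974_isGeneric_of_hasLocalComponentAt_holds
      (fun _ _ _ _ _ => JacquetShalika1981_norm_lt_sqrt_of_isGeneric_holds) P hα hv ha) fun hn P => ?_
  classical
  -- topological and measurable structures
  haveI : T2Space (GL (Fin n) (AdeleRing (𝓞 K) K)) := t2Space_gl n K
  haveI : LocallyCompactSpace (GL (Fin n) (AdeleRing (𝓞 K) K)) :=
    AdelicGroupData.locallyCompactSpace_generalLinearGroup_adeleRing K (Fin n)
  haveI := secondCountableTopology_generalLinearGroup_adeleRing K (Fin n)
  haveI : T2Space (AdeleRing (𝓞 K) K) := t2Space_adeleRing K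
  letI : MeasurableSpace (AdeleRing (𝓞 K) K) := borel _
  haveI : BorelSpace (AdeleRing (𝓞 K) K) := ⟨rfl⟩
  haveI := borelSpace_ideleGroup K
  haveI := locallyCompactSpace_ideleGroup K
  haveI := secondCountableTopology_ideleGroup K
  haveI := secondCountableTopology_adeleRing K
  haveI := locallyCompactSpace_adeleRing' K
  haveI : CompactSpace ↥(maximalCompactAdelic n K) :=
    isCompact_iff_compactSpace.1 (isCompact_maximalCompactAdelic n K)
  haveI : LocallyCompactSpace ↥(adelicUnipotent n K) := (isClosed_adelicUnipotent n K).locallyCompactSpace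
  haveI : SecondCountableTopology (AdelicGroupData.gl n K).Adelic :=
    secondCountableTopology_generalLinearGroup_adeleRing K (Fin n)
  haveI : SecondCountableTopology ↥(maximalCompactAdelic n K) := TopologicalSpace.Subtype.secondCountableTopology _
  -- Haar measures
  obtain ⟨νI, hνI⟩ := exists_isHaarMeasure_ideleGroup K
  haveI hνIR : νI.IsMulRightInvariant := by
    haveI := isInvInvariant_of_isHaarMeasure_ideleGroup (K := K) νI
    infer_instance
  set μ : Measure (Fin n → AdeleRing (𝓞 K) K) := Measure.addHaar with hμ
  set νA : Measure (Fin n → ideleGroup K) := Measure.haar with hνA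
  set νK : Measure ↥(maximalCompactAdelic n K) := Measure.haar with hνK
  set ν₀ : Measure ↥(adelicUnipotent n K) := Measure.haar with hν₀
  haveI hν₀R : ν₀.IsMulRightInvariant := isMulRightInvariant_of_isHaarMeasure_adelicUnipotent ν₀
  -- (1) a Satake family and the test datum of the hypothesis, with its level
  obtain ⟨S₁, β₀, -, hβ₀⟩ := exists_isSatakeFamilyOf_holds (n := n) (K := K) (μ := μ') P
  obtain ⟨f, η, hη, -, hne, -⟩ := P.exists_isTestFunctionGL_smoothedForm_ne_zero
  obtain ⟨𝔫₀, h𝔫₀, hηK⟩ := hη.exists_forall_mul_left_eq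
  have hηc : Continuous η := hη.continuous
  have hηs : HasCompactSupport η := hη.hasCompactSupport
  have hcusp : ((f : P.1.toSubmodule) : (AdelicGroupData.gl n K).L2 μ') ∈ cuspidalSubspace n K μ' :=
    P.le_cuspidalSubspace f.2
  -- (2) the Whittaker coefficient: continuity, a non-vanishing torus point with integral last entry
  have hψ : IsGlobalAddChar K (adeleAddChar K) := isGlobalAddChar_adeleAddChar (K := K)
  have h𝓕 : IsFundamentalDomain ↥(rationalUnipotent n K) (unipotentTateDomain n K) ν₀ :=
    isFundamentalDomain_unipotentTateDomain ν₀
  have h𝓕c : IsCompact (closure (unipotentTateDomain n K)) := isCompact_closure_unipotentTateDomain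
  have h𝓕m : MeasurableSet (unipotentTateDomain n K) := measurableSet_unipotentTateDomain
  set φ : GL (Fin n) (AdeleRing (𝓞 K) K) → ℂ :=
    invQuot (AdelicGroupData.gl n K) (smoothedForm η ((f : P.1.toSubmodule) : (AdelicGroupData.gl n K).L2 μ'))
    with hφ
  have hφc : Continuous φ := continuous_invQuot_smoothedForm hηc hηs _
  have hφinv : IsLeftInvariant (AdelicGroupData.gl n K) φ := isLeftInvariant_invQuot _ _
  set W : GL (Fin n) (AdeleRing (𝓞 K) K) → ℂ :=
    whittakerCoeff ν₀ (unipotentTateDomain n K) (adeleAddChar K) φ with hW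
  have hWc : Continuous W := continuous_whittakerCoeff h𝓕m h𝓕c hψ.continuous hφc
  have hWN : ∀ u ∈ upperUnitriangular (Fin n) (AdeleRing (𝓞 K) K), ∀ g, ‖W (u * g)‖ = ‖W g‖ := by
    intro u hu g
    have h := whittakerCoeff_unipotent_mul (ν := ν₀) (𝓕 := unipotentTateDomain n K)
      (ψ := adeleAddChar K) h𝓕 hψ hφinv ⟨u, hu⟩ g
    change W (u * g) = _ * W g at h
    rw [h, norm_mul, whittakerCharFun_apply, Circle.norm_coe, one_mul]
  obtain ⟨g₁, hg₁⟩ := exists_whittakerCoeff_invQuot_smoothedForm_ne_zero_of_one_le hn hηc hηs hcusp hne ν₀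
  obtain ⟨a₁, k₀, ha₁⟩ := exists_torusPoint_apply_ne_zero hWN hg₁
  obtain ⟨d, hd0, hdint⟩ := exists_ne_zero_valued_algebraMap_mul_le_one (K := K) (lastEntry a₁)
  have hdK : (d : K) ≠ 0 := RingOfIntegers.coe_ne_zero_iff.mpr hd0
  set c : Kˣ := Units.mk0 (d : K) hdK with hc
  set ξ : ideleGroup K := Units.map (algebraMap K (AdeleRing (𝓞 K) K) : K →* AdeleRing (𝓞 K) K) c
    with hξ
  have hξval : ((ξ : ideleGroup K) : AdeleRing (𝓞 K) K) = algebraMap K (AdeleRing (𝓞 K) K) (d : K) := by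
    rw [hξ, Units.coe_map, hc, Units.val_mk0]
    rfl
  set a₀ : Fin n → ideleGroup K := (fun _ => ξ) * a₁ with ha₀
  have ha₀W : W (torusPoint n K (a₀, k₀)) ≠ 0 := by
    have e : W (torusPoint n K (a₀, k₀)) = W (torusPoint n K (a₁, k₀)) := by
      rw [ha₀, torusPoint_mul, hW, hξ]
      exact whittakerCoeff_glDiagonal_const_mul ν₀ _ _ hφinv c _
    rw [e]
    exact ha₁
  have hlast : lastEntry a₀ = ξ * lastEntry a₁ := by
    rw [ha₀, lastEntry_mul]
    congr 1
    unfold lastEntry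
    rw [dif_pos (by omega : 0 < n)]
  have hint : ∀ w : HeightOneSpectrum (𝓞 K),
      Valued.v (((lastEntry a₀ : ideleGroup K) : AdeleRing (𝓞 K) K).2 w) ≤ 1 := by
    intro w
    rw [hlast, Units.val_mul, hξval]
    exact hdint w
  -- (3) the exceptional finite set `S'` and the good places
  obtain ⟨Sψ, hSψ⟩ := exists_finset_adicComponent_adeleAddChar_unramified (K := K)
  set S₀ : Finset (HeightOneSpectrum (𝓞 K)) :=
    S₁ ∪ (Ideal.finite_factors h𝔫₀).toFinset ∪ Sψ ∪ (finite_setOf_exists_valued_ne_one a₀).toFinset with hS₀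
  set S' : Set (HeightOneSpectrum (𝓞 K)) := ↑S₀ with hS'
  have hS'fin : S'.Finite := S₀.finite_toSet
  have hS₁S' : (↑S₁ : Set (HeightOneSpectrum (𝓞 K))) ⊆ S' := by
    intro v hv
    simp only [hS', hS₀, Finset.coe_union, Set.mem_union, Finset.mem_coe] at hv ⊢
    exact Or.inl (Or.inl (Or.inl hv))
  have hgood : ∀ v ∉ S', ¬ v.asIdeal ∣ 𝔫₀ ∧ v ∉ Sψ ∧
      ∀ i, Valued.v (((a₀ i : ideleGroup K) : AdeleRing (𝓞 K) K).2 v) = 1 := by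
    intro v hv
    have hv0 : v ∉ S₀ := fun h => hv h
    simp only [hS₀, Finset.mem_union, Set.Finite.mem_toFinset, Set.mem_setOf_eq, not_or,
      not_exists, ne_eq, not_not] at hv0
    exact ⟨hv0.1.1.2, hv0.1.2, hv0.2⟩
  have hGood : ∀ v ∉ S', ¬ v.asIdeal ∣ 𝔫₀ ∧
      (∀ c ∈ 𝒪[v.adicCompletion K], (adeleAddChar K).adicComponent v c = 1) ∧
      ∀ ϖ : v.adicCompletion K, Valued.v ϖ = WithZero.exp (-1 : ℤ) →
        ∃ c ∈ 𝒪[v.adicCompletion K], (adeleAddChar K).adicComponent v (ϖ⁻¹ * c) ≠ 1 := by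
    intro v hv
    obtain ⟨h1, h2, -⟩ := hgood v hv
    exact ⟨h1, (hSψ v h2).1, (hSψ v h2).2⟩
  have ha₀unit : a₀ ∈ unitBox {v : HeightOneSpectrum (𝓞 K) | v ∉ S'} := fun v hv i => (hgood v hv).2.2 i
  -- enumerations of the Satake parameters off `S'`
  have hβ₀' : IsSatakeFamilyOf P S' β₀ := hβ₀.mono hS₁S'
  have hex : ∀ v : HeightOneSpectrum (𝓞 K), ∃ x : Fin n → ℂ,
      v ∉ S' → (Finset.univ : Finset (Fin n)).val.map x = β₀ v := by
    intro v
    by_cases hv : v ∉ S'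
    · obtain ⟨x, hx⟩ := exists_univ_val_map_eq (hβ₀'.card_eq hv)
      exact ⟨x, fun _ => hx⟩
    · exact ⟨fun _ => 0, fun h => absurd h hv⟩
  choose x hx using hex
  -- (4) the Gaussian test function
  set Φ : (Fin n → AdeleRing (𝓞 K) K) → ℝ := standardTestFun n K (gaussArchTestFun n K) with hΦ
  have hΦS : (fun y => (Φ y : ℂ)) ∈ piSchwartzBruhat K (Fin n) := standardTestFun_gauss_mem_piSchwartzBruhat n K
  have hΦ0 : ∀ y, 0 ≤ Φ y := standardTestFun_gauss_nonneg n K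
  have hΦc : Continuous Φ := continuous_standardTestFun_of_continuous n K (continuous_gaussArchTestFun n K)
  have hΦm : Measurable fun g : GL (Fin n) (AdeleRing (𝓞 K) K) => Φ (lastRow n K g) :=
    (hΦc.comp continuous_lastRow).measurable
  -- (5) the residue: `(s - 1) I(s) → r ≠ 0`
  obtain ⟨-, r, -, hr, hI⟩ := P.exists_residue_datum hn νI μ hΦS
    (integral_ofReal_standardTestFun_gauss_ne_zero n K μ) hη f hne
  -- (6) the unfolding identity on the strip
  obtain ⟨C, hC, hunf⟩ :=
    exists_rankinSelbergIntegral_eq_mul_rankinSelbergTorusIntegralC (n := n) (K := K) hn μ' νI νA νK ν₀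
  -- (7) the Euler factorisation on `Re s > 1`
  have hEuler : ∀ s : ℂ, 1 < s.re →
      rankinSelbergTorusIntegralC n K νA νK W Φ s =
        partialPairL S' β₀ (conjFamily β₀) s *
          ∫ p in unitBox {v | v ∉ S'} ×ˢ Set.univ, torusIntegrandC n K W Φ s p ∂(νA.prod νK) := by
    intro s hs
    have hfin' : rankinSelbergTorusIntegral n K νA νK W Φ s.re ≠ ⊤ :=
      rankinSelbergTorusIntegral_whittakerCoeff_ne_top_of_mem_piSchwartzBruhat hn νA νK ν₀ P f hη hΦS hΦ0 hΦm hs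
    have hpos := setLIntegral_torusIntegrand_unitBox_ne_zero hWc ha₀W ha₀unit hint
      (continuous_gaussArchTestFun n K) (gaussArchTestFun_pos n K) s.re νA νK
    exact rankinSelbergTorusIntegralC_whittakerCoeff_eq_partialPairL_mul hn P hβ₀ h𝔫₀ hηc hηs hηK f h𝓕 h𝓕m
      h𝓕c hψ hS₁S' hGood (fun v hv => hx v hv) (fun z => (gaussArchTestFun_pos n K z).le) hΦm νA νK hs hfin' hpos
  -- (8) the `S'`-part as a moment `∫ G w^s dm` over the restricted measure
  set X := (Fin n → ideleGroup K) × ↥(maximalCompactAdelic n K)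
  set m : Measure X := (νA.prod νK).restrict (unitBox {v | v ∉ S'} ×ˢ Set.univ) with hm
  set G : X → ℝ := fun p =>
    ‖W (torusPoint n K p)‖ ^ 2 * Φ (lastRow n K (torusPoint n K p)) * torusWeight n K 0 p.1 with hG
  set w : X → ℝ := fun p => ∏ i : Fin n, ((IdeleClassGroup.ideleNorm K (p.1 i) : ℝ≥0) : ℝ) with hw
  have hpt : Measurable (torusPoint n K) := continuous_torusPoint.measurable
  have hGm : Measurable G :=
    (((hWc.measurable.comp hpt).norm.pow_const 2).mul (hΦm.comp hpt)).mul
      ((continuous_torusWeight 0).measurable.comp measurable_fst)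
  have hwm : Measurable w := by
    refine Finset.measurable_prod _ fun i _ => ?_
    exact measurable_coe_nnreal_real.comp
      ((continuous_ideleNorm_holds K).measurable.comp ((measurable_pi_apply i).comp measurable_fst))
  have hG0 : ∀ p, 0 ≤ G p := fun p =>
    mul_nonneg (mul_nonneg (sq_nonneg _) (hΦ0 _)) (torusWeight_nonneg 0 p.1)
  have hw0 : ∀ p, 0 < w p := fun p => prod_ideleNorm_pos p.1
  -- real moments are the real torus integrals over the unit box
  have hmom : ∀ σ : ℝ, ∫⁻ p, ENNReal.ofReal (G p * w p ^ σ) ∂m =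
      ∫⁻ p in unitBox {v | v ∉ S'} ×ˢ Set.univ, torusIntegrand n K W Φ σ p ∂(νA.prod νK) := by
    intro σ
    refine lintegral_congr fun p => ?_
    rw [torusIntegrand_eq_ofReal_mul_rpow]
  have hintegrable : ∀ σ : ℝ,
      ∫⁻ p in unitBox {v | v ∉ S'} ×ˢ Set.univ, torusIntegrand n K W Φ σ p ∂(νA.prod νK) ≠ ⊤ →
        Integrable (fun p => G p * w p ^ σ) m := by
    intro σ hσ
    refine ⟨(hGm.mul (hwm.pow_const σ)).aestronglyMeasurable, ?_⟩
    rw [hasFiniteIntegral_iff_ofReal (Eventually.of_forall fun p =>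
      mul_nonneg (hG0 p) (Real.rpow_nonneg (hw0 p).le σ)), hmom σ]
    exact lt_top_iff_ne_top.2 hσ
  -- second moment: the global finiteness at `σ = 2`; all moments `σ > 1` are finite
  have h2 : Integrable (fun p => G p * w p ^ (2 : ℝ)) m := by
    refine hintegrable 2 (ne_top_of_le_ne_top ?_ (setLIntegral_le_lintegral _ _))
    have h := rankinSelbergTorusIntegral_whittakerCoeff_ne_top_of_mem_piSchwartzBruhat hn νA νK ν₀ P f hη hΦS
      hΦ0 hΦm (σ := 2) (by norm_num)
    exact h
  -- the identity `I(s) = C · (∫ G w^s dm) · L^{S'}(s)` on the strip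
  have hstrip : ∀ᶠ s in 𝓝[{s : ℂ | 1 < s.re}] 1, 1 < s.re ∧ s.re < 2 := by
    have h2' : ∀ᶠ s in 𝓝 (1 : ℂ), s.re < 2 :=
      (Complex.continuous_re.tendsto (1 : ℂ)).eventually (eventually_lt_nhds (by norm_num))
    exact eventually_mem_nhdsWithin.and (eventually_nhdsWithin_of_eventually_nhds h2')
  have hid : ∀ᶠ s in 𝓝[{s : ℂ | 1 < s.re}] 1,
      rankinSelbergIntegral μ' νI (fun y => (Φ y : ℂ)) s
          (star (smoothedForm η ((f : P.1.toSubmodule) : (AdelicGroupData.gl n K).L2 μ')))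
          (smoothedForm η ((f : P.1.toSubmodule) : (AdelicGroupData.gl n K).L2 μ')) =
        (C : ℂ) * (∫ p, (G p : ℂ) * (w p : ℂ) ^ s ∂m) * partialPairL S' β₀ (conjFamily β₀) s := by
    filter_upwards [hstrip] with s hs
    have hset : (∫ p in unitBox {v | v ∉ S'} ×ˢ Set.univ, torusIntegrandC n K W Φ s p ∂(νA.prod νK)) =
        ∫ p, (G p : ℂ) * (w p : ℂ) ^ s ∂m := by
      rw [hm]
      exact integral_congr_ae (Eventually.of_forall fun p => torusIntegrandC_eq_ofReal_mul_cpow s p)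
    rw [hunf P f hη hΦS hΦ0 hΦm hs.1 hs.2, hEuler s hs.1, hset]
    ring
  -- (8') THE FIRST MOMENT IS FINITE: `σ`-moments are bounded near `1⁺` by the lower bound for `L^{S'}`,
  -- and Fatou's lemma along `σ → 1⁺` bounds `∫ G w dm`
  have hfinσ : ∀ σ : ℝ, 1 < σ →
      ∫⁻ p in unitBox {v | v ∉ S'} ×ˢ Set.univ, torusIntegrand n K W Φ σ p ∂(νA.prod νK) ≠ ⊤ := fun σ hσ =>
    ne_top_of_le_ne_top
      (rankinSelbergTorusIntegral_whittakerCoeff_ne_top_of_mem_piSchwartzBruhat hn νA νK ν₀ P f hη hΦS hΦ0 hΦm hσ)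
      (setLIntegral_le_lintegral _ _)
  have hJ : ∀ σ : ℝ, (∫ p, (G p : ℂ) * (w p : ℂ) ^ ((σ : ℂ)) ∂m) = ((∫ p, G p * w p ^ σ ∂m : ℝ) : ℂ) := by
    intro σ
    rw [← integral_complex_ofReal]
    refine integral_congr_ae (Eventually.of_forall fun p => ?_)
    simp only [Complex.ofReal_mul, Complex.ofReal_cpow (hw0 p).le]
  obtain ⟨c, hc, hLB⟩ := hL P S' hS'fin β₀ hβ₀'
  -- `‖(s - 1) I(s)‖ < ‖r‖ + 1` near `1`
  have hIb : ∀ᶠ s in 𝓝[{s : ℂ | 1 < s.re}] 1,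
      ‖(s - 1) * rankinSelbergIntegral μ' νI (fun y => (Φ y : ℂ)) s
          (star (smoothedForm η ((f : P.1.toSubmodule) : (AdelicGroupData.gl n K).L2 μ')))
          (smoothedForm η ((f : P.1.toSubmodule) : (AdelicGroupData.gl n K).L2 μ'))‖ < ‖r‖ + 1 :=
    hI.norm.eventually (Iio_mem_nhds (lt_add_one _))
  have hbound : ∀ᶠ σ : ℝ in 𝓝[>] 1,
      ∫⁻ p, ENNReal.ofReal (G p * w p ^ σ) ∂m ≤ ENNReal.ofReal ((‖r‖ + 1) / (C * c)) := by
    filter_upwards [tendsto_ofReal_nhdsWithin_one.eventually hid, tendsto_ofReal_nhdsWithin_one.eventually hIb, hLB,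
      self_mem_nhdsWithin] with σ hidσ hIσ hLσ hσ1
    have hσ1' : (1 : ℝ) < σ := hσ1
    have hint : Integrable (fun p => G p * w p ^ σ) m := hintegrable σ (hfinσ σ hσ1')
    have hnn : 0 ≤ ∫ p, G p * w p ^ σ ∂m := integral_nonneg fun p => mul_nonneg (hG0 p) (Real.rpow_nonneg (hw0 p).le σ)
    -- `‖(σ-1) I(σ)‖ = C · (∫ G w^σ) · (σ-1)‖L(σ)‖`
    have hnorm : ‖((σ : ℂ) - 1) * rankinSelbergIntegral μ' νI (fun y => (Φ y : ℂ)) σ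
        (star (smoothedForm η ((f : P.1.toSubmodule) : (AdelicGroupData.gl n K).L2 μ')))
        (smoothedForm η ((f : P.1.toSubmodule) : (AdelicGroupData.gl n K).L2 μ'))‖ =
        C * (∫ p, G p * w p ^ σ ∂m) * ((σ - 1) * ‖partialPairL S' β₀ (conjFamily β₀) (σ : ℂ)‖) := by
      rw [hidσ, hJ σ]
      have hσ : ‖((σ : ℂ) - 1)‖ = σ - 1 := by
        rw [show ((σ : ℂ) - 1) = ((σ - 1 : ℝ) : ℂ) by push_cast; ring, Complex.norm_real, Real.norm_eq_abs,
          abs_of_pos (by linarith)]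
      rw [norm_mul, norm_mul, norm_mul, hσ, Complex.norm_real, Complex.norm_real, Real.norm_eq_abs, Real.norm_eq_abs,
        abs_of_pos hC, abs_of_nonneg hnn]
      ring
    have hle : C * c * (∫ p, G p * w p ^ σ ∂m) ≤ ‖r‖ + 1 := by
      have e1 : C * c * (∫ p, G p * w p ^ σ ∂m) = C * (∫ p, G p * w p ^ σ ∂m) * c := by ring
      have e2 : C * (∫ p, G p * w p ^ σ ∂m) * c ≤
          C * (∫ p, G p * w p ^ σ ∂m) * ((σ - 1) * ‖partialPairL S' β₀ (conjFamily β₀) (σ : ℂ)‖) :=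
        mul_le_mul_of_nonneg_left hLσ (mul_nonneg hC.le hnn)
      rw [e1]
      exact e2.trans (by rw [← hnorm]; exact hIσ.le)
    have hCc : 0 < C * c := mul_pos hC hc
    rw [← ofReal_integral_eq_lintegral_ofReal hint (Eventually.of_forall fun p =>
      mul_nonneg (hG0 p) (Real.rpow_nonneg (hw0 p).le σ))]
    exact ENNReal.ofReal_le_ofReal ((le_div_iff₀' hCc).2 hle)
  have hFatou : ∫⁻ p, ENNReal.ofReal (G p * w p) ∂m ≤
      liminf (fun σ : ℝ => ∫⁻ p, ENNReal.ofReal (G p * w p ^ σ) ∂m) (𝓝[>] 1) := by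
    have hpt : ∀ p, liminf (fun σ : ℝ => ENNReal.ofReal (G p * w p ^ σ)) (𝓝[>] 1) = ENNReal.ofReal (G p * w p) := by
      intro p
      refine Filter.Tendsto.liminf_eq ?_
      have h : Tendsto (fun σ : ℝ => G p * w p ^ σ) (𝓝[>] 1) (𝓝 (G p * w p ^ (1 : ℝ))) :=
        (((Real.continuousAt_const_rpow (hw0 p).ne').tendsto).const_mul (G p)).mono_left nhdsWithin_le_nhds
      rw [Real.rpow_one] at h
      exact (ENNReal.continuous_ofReal.tendsto _).comp h
    calc ∫⁻ p, ENNReal.ofReal (G p * w p) ∂m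
        = ∫⁻ p, liminf (fun σ : ℝ => ENNReal.ofReal (G p * w p ^ σ)) (𝓝[>] 1) ∂m := by simp_rw [hpt]
      _ ≤ _ := lintegral_liminf_le fun σ => (hGm.mul (hwm.pow_const σ)).ennreal_ofReal
  have h1 : Integrable (fun p => G p * w p) m := by
    refine ⟨(hGm.mul hwm).aestronglyMeasurable, ?_⟩
    rw [hasFiniteIntegral_iff_ofReal (Eventually.of_forall fun p => mul_nonneg (hG0 p) (hw0 p).le)]
    refine lt_of_le_of_lt (hFatou.trans (liminf_le_of_frequently_le' (Eventually.frequently hbound))) ?_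
    exact ENNReal.ofReal_lt_top
  -- (9) the moment lemma
  refine ⟨S', β₀, hS'fin, hβ₀', ?_⟩
  exact exists_ne_zero_tendsto_sub_one_mul_of_integral_mul_cpow hr (Complex.ofReal_ne_zero.2 hC.ne') hI
    hGm hwm hG0 hw0 h1 h2 hid

/-- **The converse**: the named fact gives the lower bound (so the two are equivalent, given the tree).
[cite: ArthurClozelAMS120, Ch. 3 §2 (2.3)] -/
theorem partialPairL_lower_bound_of_pole
    (h : JacquetShalika1981_partialPairL_pole_of_eq_conj (n := n) (K := K) (μ := μ')) (hn : 0 < n)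
    (P : CuspidalAutomorphicRepGL n K μ') {S' : Set (HeightOneSpectrum (𝓞 K))} (hS' : S'.Finite)
    {β : SatakeFamily K} (hβ : IsSatakeFamilyOf P S' β) :
    ∃ c : ℝ, 0 < c ∧ ∀ᶠ σ : ℝ in 𝓝[>] 1, c ≤ (σ - 1) * ‖partialPairL S' β (conjFamily β) (σ : ℂ)‖ := by
  obtain ⟨c, hc, hlim⟩ := h hn P P.conj (by rw [CuspidalAutomorphicRepGL.conj_conj]) hS' hβ hβ.conj
  refine ⟨‖c‖ / 2, by positivity, ?_⟩
  have hev : ∀ᶠ s in 𝓝[{s : ℂ | 1 < s.re}] 1, ‖c‖ / 2 < ‖(s - 1) * partialPairL S' β (conjFamily β) s‖ :=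
    hlim.norm.eventually (Ioi_mem_nhds (by linarith [norm_pos_iff.2 hc]))
  filter_upwards [tendsto_ofReal_nhdsWithin_one.eventually hev, self_mem_nhdsWithin] with σ hσ hσ1
  have hσ1' : (1 : ℝ) < σ := hσ1
  rw [norm_mul, show ((σ : ℂ) - 1) = ((σ - 1 : ℝ) : ℂ) by push_cast; ring, Complex.norm_real, Real.norm_eq_abs,
    abs_of_pos (by linarith)] at hσ
  exact hσ.le

end LowerBound

end Literature.NumberTheory.Automorphic
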